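import Summits.QuantumFields.BalabanUV.T4Continuum.Support.VariationalCovariantTwoRunsNE3
import Summits.QuantumFields.BalabanUV.T4Continuum.Support.MinimalActionRate

/-!
# T⁴ programme, spine node NE2 (U1a), lane P2 — SUPPLIER ITEM (O2) «L-NE3» ON NODE NE3's OWN LANDED CARRIER `MinimalActionRate.minActReadings`
# (row B6′ pattern, by name on both ends): the two-runs adapter's `LocalRate` binder IS node U1b's local half on NE3's readings of the two runs'
# minimisers with the consumer-supplied P2 reading `p2Loc`, datum by datum

NE2 formalisation swarm `b2b-balaban-t4-ne2-formalise-*`, leaf prover 09 (gen 4); the road owner's request CLAIMS.log l.10100 («typing (O2) ALSO on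
NE3's own carrier … so the NE3 swarm's root plugs by name»).  Inputs BY NAME: `Support/VariationalCovariantTwoRuns` (`famReadings`, `towReadings`,
`reading`, `part`, `localRate_famReadings_iff`), `Support/VariationalCovariantTwoRunsNE3` (`coarsen`, `fineOf`, `sq_lev_mul_norm_coarsen_sub_le_of_localRate`,
`lev_mul_norm_coarsen_sub_le_of_localRate_max`), `Support/MinimalActionRate.minActReadings` (NE3 lineage, owner t4-ne3-p1: data = unit-lattice
configurations `V`, `act k V` = the minimal level-`k` action, `vol = N^d`, local reading `loc` SUPPLIED BY THE CONSUMER), node U1b's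
`T4EtaRateMin.{LocalRate, ActionRate, NE3Shape}`.
 * §1 **`p2Loc Rt`** — the P2 consumer's local reading: at the address `s`, after `k` steps, `Re∕Im (L^k·(Rt V k (pt s k) μ − 1))` of the datum's tower
   `Rt V` (DATA: `Rt : V ↦ (k ↦ R_k)`; the reading «`Rt V k` = the axial-gauge phases of the `k`-step run's minimiser `U_k(V)`» is NOT asserted — no B0);
   **`localRate_minActReadings_iff`**: `LocalRate (minActReadings d 𝒞 L N dom (p2Loc L M Rt)) C θ ↔ LocalRate (famReadings L M Rt dom) C θ`
   (`Iff.rfl` — same admissible data, same local reading) `↔ LocalRate (towReadings L M (Rt '' dom)) C θ`; `ne3Shape_minActReadings_iff` splits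
   `NE3Shape` on that carrier into rate honesty ∧ NE3-(A)'s `ActionRate` ∧ the two-runs binder.
 * §2 **`sq_lev_mul_norm_coarsen_sub_le_of_minActReadings`**: from node U1b's local half ON NE3's CARRIER (`0 ≤ C`, `0 ≤ θ ≤ L⁻¹`) and the size class,
   for EVERY admissible datum `V ∈ dom`, level `k` and coarse bond: `(L^k)²·‖coarsen (fineOf (Rt V) k) (y,μ) − Rt V k y μ‖ ≤ 2C + (α²∕2)e^α` — the
   road owner's END class currency `n²·m_k ≤ c_m` for the NE3 part of the spliced tower's mismatch; `lev_mul_norm_coarsen_sub_le_of_minActReadings_max`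
   (any `0 ≤ θ`, rate `max θ L⁻¹`); `…_of_ne3Shape` (from the full `NE3Shape`, whose `θ < 1` is all the rate needs).
WHAT IS LEFT (stated, not hidden): the NE3 tree inhabits NO local half today (route (A) = the ACTION half `actionRate_of_sandwichData`); whether `p2Loc`
(axial-gauge phase entries at block-addressed bonds = reading (F) «fields at King-corresponding bonds») is node U1b's local deliverable is the NE3
owner lineage's word — the carrier was built to let the consumer choose it; nothing of NE3 is proved here.

HONEST FRAMING (T4-DAG p. 1).  Bookkeeping (`Iff.rfl` + compositions BY NAME); `Rt` DATA; NE3 OPEN (DISPLAYED); NE2 NOT proved; model level (U(1)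
charged-scalar sector of road P2); spine PROVED 0∕9 unchanged; rung (B)+1 finite T⁴ — NOT infinite volume, NOT a mass gap, NOT Clay.  HONEST DEPENDENCY
(cell, verbatim): continuum YM on T⁴ ⇐ BetaPertH ∧ nine spine estimates (0/9 proved); BetaPertH ⇐ (D1) ∧ (D4) ∧ CAP+tail; G-an2-4 gates asym, D1 and
NE2/3/4.  ABSOLUTE RULE kept; no `def … : Prop` fact; no `sorry`.
-/

noncomputable section

open scoped BigOperators ComplexConjugate

namespace Summit.QuantumFields.BalabanUV.T4Continuum.NE2VariationalTwoRunsFromNE3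

open Literature.MathematicalPhysics.QuantumFieldTheory.Balaban1983to89
open Literature.MathematicalPhysics.QuantumFieldTheory.Balaban1983to89.B5Prop11Plancherel (Tor fine)
open Literature.MathematicalPhysics.QuantumFieldTheory.Balaban1983to89.T4EtaRateMin (Readings LocalRate ActionRate NE3Shape)
open Summit.QuantumFields.BalabanUV.T4Continuum.VariationalCovariantTwoRuns
open Summit.QuantumFields.BalabanUV.T4Continuum.VariationalCovariantTwoRunsNE3
open Summit.QuantumFields.BalabanUV.T4Continuum.MinimalActionRate (minActReadings)

variable {d : ℕ} (L : ℕ) [NeZero L] (M : Fin d → ℕ) [hM : ∀ μ, NeZero (M μ)]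
variable {o : Type*} [Fintype o] [DecidableEq o]

/-! ## §1 The P2 reading on NE3's carrier -/

/-- **THE P2 CONSUMER's LOCAL READING** for node NE3's carrier: at the address `s`, after `k` steps, `Re∕Im (L^k·(Rt V k (pt s k) μ − 1))` of the
datum's connection tower `Rt V` (= `(famReadings L M Rt dom).loc`, independent of `dom`). [folklore] -/
def p2Loc {ι : Type*} (Rt : ι → ((k : ℕ) → Tor (fine (L ^ k) M) → Fin d → ℂ)) : ℕ → ι → Site L M → ℝ :=
  fun k V s => part s.re (reading L M (Rt V) k s)

section Carrier

variable {𝒞 : ℕ → Set (B7Prop1Explicit.Site d → Fin d → (Matrix o o ℂ)ˣ)} {N : ℕ}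
  {dom : Set (B7Prop1Explicit.Site d → Fin d → (Matrix o o ℂ)ˣ)}
  {Rt : (B7Prop1Explicit.Site d → Fin d → (Matrix o o ℂ)ˣ) → ((k : ℕ) → Tor (fine (L ^ k) M) → Fin d → ℂ)} {C θ : ℝ}

omit [NeZero L] hM in
/-- NE3's carrier with the P2 reading: admissible data and local reading, unfolded (`rfl`). [folklore] -/
theorem minActReadings_p2Loc_loc :
    (minActReadings d 𝒞 L N dom (p2Loc L M Rt)).dom = dom ∧ (minActReadings d 𝒞 L N dom (p2Loc L M Rt)).loc = p2Loc L M Rt :=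
  ⟨rfl, rfl⟩

omit [NeZero L] hM in
/-- **THE (O2) BINDER ON NODE NE3's OWN CARRIER**: node U1b's `LocalRate` on `minActReadings d 𝒞 L N dom (p2Loc L M Rt)` — the NE3 lineage's readings
of the two runs' minimisers with the P2 consumer's local reading — IS the two-runs adapter's family binder (same data, same reading). [folklore] -/
theorem localRate_minActReadings_iff :
    LocalRate (minActReadings d 𝒞 L N dom (p2Loc L M Rt)) C θ ↔ LocalRate (famReadings L M Rt dom) C θ :=
  Iff.rfl

omit [NeZero L] hM in
/-- … and hence the class binder on the image class `Rt '' dom` (file 1's `localRate_famReadings_iff`). [folklore] -/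
theorem localRate_minActReadings_iff_tow :
    LocalRate (minActReadings d 𝒞 L N dom (p2Loc L M Rt)) C θ ↔ LocalRate (towReadings L M (Rt '' dom)) C θ :=
  (localRate_minActReadings_iff L M).trans (localRate_famReadings_iff L M Rt dom C θ)

omit [NeZero L] hM in
/-- `NE3Shape` on that carrier = rate honesty ∧ NE3-(A)'s `ActionRate` (the NE3 swarm's ROOT-A target, by name) ∧ the two-runs binder. [folklore] -/
theorem ne3Shape_minActReadings_iff :
    NE3Shape (minActReadings d 𝒞 L N dom (p2Loc L M Rt)) C θ ↔
      (0 ≤ θ ∧ θ < 1) ∧ ActionRate (minActReadings d 𝒞 L N dom (p2Loc L M Rt)) C θ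
        ∧ LocalRate (towReadings L M (Rt '' dom)) C θ :=
  ⟨fun h => ⟨⟨h.rate_nonneg, h.rate_lt_one⟩, h.action, (localRate_minActReadings_iff_tow L M).1 h.pointwise⟩,
    fun h => ⟨h.1.1, h.1.2, h.2.1, (localRate_minActReadings_iff_tow L M).2 h.2.2⟩⟩

/-! ## §2 The END's class currency for every admissible datum, from node U1b's local half on NE3's carrier -/

/-- **`n²·m ≤ c` FOR THE NE3 PART OF THE SPLICED TOWER's MISMATCH, datum by datum**, from `LocalRate` on NE3's carrier (`0 ≤ C`, `0 ≤ θ ≤ L⁻¹` —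
e.g. NE3-(A)'s `(L²)⁻¹`) and the size class: `(L^k)²·‖coarsen (fineOf (Rt V) k) (y,μ) − Rt V k y μ‖ ≤ 2C + (α²∕2)e^α`. [folklore] -/
theorem sq_lev_mul_norm_coarsen_sub_le_of_minActReadings {α : ℝ} (hC : 0 ≤ C) (hθ : 0 ≤ θ) (hθL : θ ≤ (L : ℝ)⁻¹) (hα : 0 ≤ α)
    (h : LocalRate (minActReadings d 𝒞 L N dom (p2Loc L M Rt)) C θ) {V : B7Prop1Explicit.Site d → Fin d → (Matrix o o ℂ)ˣ} (hV : V ∈ dom)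
    (hsize : ∀ k x μ, ‖((L ^ k : ℕ) : ℂ) * (Rt V k x μ - 1)‖ ≤ α) (k : ℕ) (y : Tor (fine (L ^ k) M)) (μ : Fin d) :
    ((L ^ k : ℕ) : ℝ) ^ 2 * ‖coarsen L (fine (L ^ k) M) (fineOf L M (Rt V) k) y μ - Rt V k y μ‖ ≤ 2 * C + α ^ 2 / 2 * Real.exp α :=
  sq_lev_mul_norm_coarsen_sub_le_of_localRate L M hC hθ hθL hα ((localRate_minActReadings_iff_tow L M).1 h) ⟨V, hV, rfl⟩ hsize k y μ

/-- the same at ANY honest rate `0 ≤ θ`: `L^k·‖…‖ ≤ (2C + (α²∕2)e^α)·(max θ L⁻¹)^k` (the road owner's CLASS-θ variant). [folklore] -/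
theorem lev_mul_norm_coarsen_sub_le_of_minActReadings_max {α : ℝ} (hC : 0 ≤ C) (hθ : 0 ≤ θ) (hα : 0 ≤ α)
    (h : LocalRate (minActReadings d 𝒞 L N dom (p2Loc L M Rt)) C θ) {V : B7Prop1Explicit.Site d → Fin d → (Matrix o o ℂ)ˣ} (hV : V ∈ dom)
    (hsize : ∀ k x μ, ‖((L ^ k : ℕ) : ℂ) * (Rt V k x μ - 1)‖ ≤ α) (k : ℕ) (y : Tor (fine (L ^ k) M)) (μ : Fin d) :
    ((L ^ k : ℕ) : ℝ) * ‖coarsen L (fine (L ^ k) M) (fineOf L M (Rt V) k) y μ - Rt V k y μ‖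
      ≤ (2 * C + α ^ 2 / 2 * Real.exp α) * (max θ (L : ℝ)⁻¹) ^ k :=
  lev_mul_norm_coarsen_sub_le_of_localRate_max L M hC hθ hα ((localRate_minActReadings_iff_tow L M).1 h) ⟨V, hV, rfl⟩ hsize k y μ

/-- from the full `NE3Shape` on NE3's carrier (its `0 ≤ θ < 1` is all the rate needs; `0 ≤ C`): the CLASS-θ form. [folklore] -/
theorem lev_mul_norm_coarsen_sub_le_of_ne3Shape {α : ℝ} (hC : 0 ≤ C) (hα : 0 ≤ α)
    (h : NE3Shape (minActReadings d 𝒞 L N dom (p2Loc L M Rt)) C θ) {V : B7Prop1Explicit.Site d → Fin d → (Matrix o o ℂ)ˣ} (hV : V ∈ dom)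
    (hsize : ∀ k x μ, ‖((L ^ k : ℕ) : ℂ) * (Rt V k x μ - 1)‖ ≤ α) (k : ℕ) (y : Tor (fine (L ^ k) M)) (μ : Fin d) :
    ((L ^ k : ℕ) : ℝ) * ‖coarsen L (fine (L ^ k) M) (fineOf L M (Rt V) k) y μ - Rt V k y μ‖
      ≤ (2 * C + α ^ 2 / 2 * Real.exp α) * (max θ (L : ℝ)⁻¹) ^ k :=
  lev_mul_norm_coarsen_sub_le_of_minActReadings_max L M hC h.rate_nonneg hα h.pointwise hV hsize k y μ

end Carrier

end Summit.QuantumFields.BalabanUV.T4Continuum.NE2VariationalTwoRunsFromNE3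

end
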